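import Literature.NumberTheory.EllipticCurves.CastellaGrossiLeeSkinner2022.BDPValueAtTrivialCharacter
import HarnessLib

/-!
# Keller–Yin (arXiv:2402.12781v2) Thm. 3.0.8 (IMC2) at the trivial character, combined with the
# Bertolini–Darmon–Prasanna formula ([CGLS] Thm. 5.1.3): the anticyclotomic main conjecture for the
# GOOD LATTICE at an ANOMALOUS Eisenstein prime, read at `𝟙` — an explicitly labelled OPEN hypothesis
# on the Literature object `X_ac`

HONEST FRAMING (cell `bsd-eis`, home `run/shared/lean/pub/bsd-eis/`; FULL-BSD rank-≤1 programme,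
row A1 = class X1 ∩ {`r_an = 1`, parity type A}: good anomalous Eisenstein prime `p > 2`, 7 892 open
census cells). T. Keller, M. Yin, *On the anticyclotomic Iwasawa theory of newforms at Eisenstein
primes of semistable reduction*, arXiv:2402.12781v2 (30 Oct 2024) is an UNREFEREED PREPRINT. Nothing
in this file is a theorem of the tree: the one `def … : Prop` below transcribes KY's Theorem 3.0.8
(label `IMC`, statement (IMC2)) SPECIALISED to weight `2` / an elliptic curve over `ℚ` and READ AT THE
TRIVIAL CHARACTER, combined — exactly as Castella–Grossi–Lee–Skinner combine their Thm. 4.2.2 with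
their Thm. 5.1.3 in the proof of their Thm. 5.3.1 (display (5.4)) — with the PUBLISHED BDP formula
[CGLS] Thm. 5.1.3, in the currency of the sibling fact
`CastellaGrossiLeeSkinner2022.display54_thm513_generator_constantCoeff` (the non-anomalous twin,
PUBLISHED). It carries the suffix `_OPEN` and the tag `[claim: KellerYin2024, status: under-review]`
and is to be taken as an explicit hypothesis. Seat `bsd-eis-ky` (prover, Keller–Yin verification),
gen 3.

STATUS OF THE CLAIM (numbers, not adjectives). The cell's line-by-line verification of exactly this
statement is `HOME/bsd-eis-ky-MEMO-1.md` §2 (links L5–L9, L11) + §3 (audit of KY's one new input, the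
`λ/μ`-comparison "mulambda" at an anomalous prime: algebraic side A1–A9 with OUR uniform derivation
§3A′ replacing KY's Cases I–III — KY's printed Case I row, v2 TeX L1202, is false but void for non-CM
curves —, analytic side B1–B4, bridge R1–R4 with KY's wrong-tower citations repaired by a
two-variable descent; input (I2) closed by citation in `HOME/bsd-eis-ky-MEMO-2.md` §11: Perrin-Riou,
Mém. SMF 17 (1984) II Thm. 23/25 + Greenberg 1978), scored **PASS** (no SMUGGLED line, no
unacknowledged GAP) by the cell's cross-family referee (`HOME/REF-VERDICT-ky-MEMO-1.md` §3, §5). The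
label stays `_OPEN` (PREPRINT) until the planner / coordinator rule otherwise; this file changes no
status. Links of the printed argument and their standing: Kolyvagin system from Heegner points on the
good lattice — [CGLS] Thm. 4.1.1 + Rem. 4.1.2 (Howard 2004 with `E(K)[p] = 0` replacing surjectivity;
Cornut–Vatsal) [PUB]; Howard's structure theorem [CGLS] Thm. 3.2.1 / Cor. 3.2.2 / Thm. 4.1.3 under
(h1) `E(K)[p] = 0` [PUB]; equivalence IMC1 ⇔ IMC2 divisibility by divisibility after inverting `p`,
[CGLS] Prop. 4.2.1 = Burungale–Castella–Kim 2021 Thm. 5.2 [PUB]; `μ(𝔛) = μ(𝓛) = 0`,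
`λ(𝔛) = λ(𝓛)` at an anomalous prime — KY Thm. 1.5.1 (`algmain`) + Thms. 2.2.2/2.2.3 (`anacomp`)
[PRE; memo §3]; whence equality in IMC2 (memo L9, commutative algebra); the value at `𝟙`:
Bertolini–Darmon–Prasanna 2013 Thm. 5.13 / Castella–Hsieh 2018 = [CGLS] Thm. 5.1.3, "let `p > 2` be
a prime of good reduction for `E` such that `p = v v̄` splits in `K`" — NO condition on the isogeny
characters [PUB]. At a good `p = 3` every BDP-type input admits `p = 3` (BDP13 Assumption 5.12 has no
size/parity condition on `p`; planner ROUTING v1.4 (2)); KY state `p > 2` throughout (`p ∤ 2N`; the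
one "`p > 3`" of the TeX, L1462, describes [CW78]).

## The good lattice (KY §0.2, Prop. 1.3.1 `omega first non-split`, §1.4 (eq. `char to f`), L885)

KY fix, by Ribet's lemma, the member `T_f` of the isogeny class for which "`ρ̄_f|_{G_K}` [is]
non-split with no trivial subrepresentation and there is a short exact sequence
`0 → 𝔽(φ̃) → ρ̄_f|_{G_K} → 𝔽(ψ̃) → 0` with `φ = φ̃|_{G_{K_v}} = ω`", and prove (IMC2) for it under
"`p = v v̄` splits in `K` and `H⁰(K, ρ̄_f) = 0`" (Thm. 3.0.8; Rem. 3.0.9 `allowtor` extends to other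
lattices by [Kobayashi–Ota Prop. 2.9] — NOT transcribed here). For an elliptic curve at a good
ordinary `p > 2` the characters of `E[p]^{ss}|_{I_p}` are `{ω, 1}`, so "the sub-line restricts to `ω`
at `p`" = "the (then unique) rational `p`-line of `E` is RAMIFIED at `p`", and "non-split" excludes a
second, unramified, rational line. In the cell's predicates (`Rank1Residual/Predicates.lean`:
`IsRationalLine`, `LineUnramifiedAt` = every inertia group above `p` acts trivially) the lattice
normalisation therefore reads: **no rational `p`-line of `W` is unramified at `p`**,
`∀ Φ, IsRationalLine W p Φ → ¬ LineUnramifiedAt W p Φ`. KY's `H⁰(K, ρ̄_f) = 0` is kept VERBATIM as the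
separate binder `∀ Q : E(K), p • Q = 0 → Q = 0` (it follows from the normalisation for `K` quadratic
with `p` unramified in `K` — a Clifford argument on the index-two subgroup `Γ_K`, carried out in the
cell's Summits file `Summits/BirchSwinnertonDyer/Rank1Residual/X1/KellerYinGoodLattice.lean` — but it
is PRINTED, so it is kept). Examples: `11a2` at `5` (not `11a1 = X₀(11)`, whose `E[5]` is
split, nor `11a3 = X₁(11)`, whose line is `𝔽_5`); the `ψ̃ = 1` case ("case (a)", 1 438 of the 1 487
type-A census classes) and the `ψ̃ = ε ≠ 1` case ("case (b)", 49 classes) are both covered.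

## Citation header

* T. Keller, M. Yin, arXiv:2402.12781v2 (2024-10-30; TeX source of record
  `HOME/lit/src/ky24-v2/main.tex`, concordance `HOME/lit/INDEX.md`): **Theorem 3.0.8** (label `IMC`,
  L1618–L1629), verbatim: "Assume `f` has weight `2r` where `r` is odd. Assume that `p = v v̄` splits
  in `K` and `H⁰(K, ρ̄_f) = 0`. Then the following statements hold: … (IMC2) Both `H¹_{𝓕_nr}(K,𝐓)` and
  `𝔛_f = H¹_{𝓕_nr}(K,M_f)^∨` are `Λ`-torsion, and the equality `Char_Λ(𝔛_f)Λ^nr = (𝓛_f)` holds in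
  `Λ^nr`." Standing hypotheses §0.1 (L233–L235): "`K/ℚ` a Heegner field for `N` … `D_K` odd and
  `≠ −3`, and `p = v v̄` splits in `K`"; `p > 2`, `p ∤ N` (good); `𝓛_f` = the BDP `p`-adic
  `L`-function of §2.1.1 (= [CGLS] Thm. 2.1.1 for `k = 2`); the lattice as in §1.4 (above). Proof
  of Thm. 3.0.8 as PRINTED (L1631–L1640): Kolyvagin argument (KY Thms. 3.0.3–3.0.6) ⇒ one
  divisibility in (IMC1) ⇒ in (IMC2) ([CGLS] Prop. 4.2.1, [BCK21] Thm. 5.2, "the equivalence is done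
  with the Greenberg Selmer groups, but they generate the same characteristic ideals as the
  unramified Selmer group do") ⇒ equality by `algmain` + `anacomp`. THE CELL'S VERIFIED ROUTE (memo
  §2 L5–L6) takes the weight-2 Kolyvagin system from the PUBLISHED [CGLS] Thm. 4.1.1 + Rem. 4.1.2 =
  Howard, Compos. Math. 140 (2004) Thms. 1/2 (arXiv:1202.6340: `p` odd; `p`, `D`, `N` pairwise
  coprime; `E(K)[p] = 0` replacing surjectivity, as [CGLS] L2203–L2208 print with NO line on `p`) and
  Cornut–Vatsal — NOT from KY's own weight-`2r` Thm. 3.0.6 (`Koly`), which imports Longo–Vigni's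
  classes and with them LV's admissibility `p ∤ 6Nφ(N)c_f` (memo MEMO-2 D4′; that rider is thereby
  kept OFF row A1, in particular off its 8 173 pairs at `p = 3`). No Longo–Vigni / Castella–Hsieh
  ARITHMETIC theorem is on the route at weight 2 (Castella–Hsieh enter only through the construction
  Def. 3.5 / Prop. 3.6, "odd `p ∤ N`", and Hsieh 2014 Thm. 1). In v1 (store text
  `paper:arxiv-2402.12781`) Thm. 3.0.8 is "Thm. 3.0.11"; the tree's `KellerYin2024/AnomalousBSD.lean`
  records the v1↔v2 numbering. UNREFEREED PREPRINT. Bib key `KellerYin2024`.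
* F. Castella, G. Grossi, J. Lee, C. Skinner, Invent. Math. **227** (2022) = arXiv:2008.02571v2:
  **Thm. 5.1.3** (TeX `thmpadicGZ`, L2463–L2471) with §5.1.2 (L2434–L2447) — the BDP formula
  `𝓛_E(0) = c_E⁻² · (1 − a_p p⁻¹ + p⁻¹)² · log_{ω_E}(P_K)²`, "`p > 2` … good reduction … `p = v v̄`
  splits in `K`"; proof of Thm. 5.3.1, display (5.4) `𝓕_E(0) = u · 𝓛_E(0)`, `u ∈ (ℤ_p^ur)^×`
  (L2616–L2634) — the PATTERN of the combination. REFEREED / PUBLISHED. Bib key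
  `CastellaGrossiLeeSkinner2022`.
* Dictionary (identical to `display54_thm513_generator_constantCoeff`, module docstring of
  `BDPValueAtTrivialCharacter.lean`, word for word): `W` globally minimal; `2 < p`, `Good W p`,
  `Red W p`; HERE `Anom W p` (`a_p ≡ 1 (mod p)`, = "one of `φ|_{G_p}, ψ|_{G_p}` is trivial", KY §1.4
  L1079, the case [CGLS] exclude) INSTEAD of `¬ Anom W p`, plus the lattice normalisation and
  `H⁰(K, ρ̄) = 0`; `K` with (Heeg), (spl), (disc) `D_K` odd `≠ −3`, (Sel) `corank_{ℤ_p} Sel_{p^∞}(E/K)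
  = 1` (kept from [CGLS] Thm. 4.2.2's shape — weaker than KY's print, never stronger; at the cell's
  data it holds by Gross–Zagier–Kolyvagin); `(ι, v, vbar, κ, γ)` and `𝔛_E = AcSelmer.XAc (W.baseChange
  K) p κ vbar ∅ γ` — Castella's `X_ac` strict at `v̄`, relaxed at `v`, trivial at `w ∤ p`, i.e. the
  GREENBERG Selmer group of [CGLS] §1.4, which by KY's own sentence (L1633–L1634) has the same
  characteristic ideal as their `𝓕_nr`-group (memo A8: the two duals differ by a finite cyclic
  module, KY Lemma 1.3.6); `(Dt, H, ιC, P)` with `Dt.c = c_E`, `ιC(P) = P_K`; `log_{ω_E}(P_K) =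
  log_W(z(m₀ • P_ι))/m₀` (`padicLogPoint`, `formalIndex`, `padicPointOf`); the unit `u ∈ ℚ_p ∩
  (ℤ_p^ur)^× = ℤ_p^×` (or `u := 1` when the value vanishes), as in the sibling.

## Contents

* `thm308_imc2_bdpValue_goodLattice_OPEN` — the OPEN named fact (ONE new `def … : Prop`).
* PROVED (bookkeeping, verbatim the sibling's): `generator_constantCoeff_eq_of_thm308` (every
  generator, with its own unit), `valuation_generator_constantCoeff_of_thm308` (the identity in
  valuations: `ord_p 𝓕(0) = 2·(ord_p(1 − a_p + p) − 1 + ord_p log_{ω_E} P_K) − 2·ord_p c_E` for every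
  generator with `𝓕(0) ≠ 0`), `hasCharValuationAt_of_thm308` (the packaged currency
  `AcSelmer.XAc.HasCharValuationAt … n ∧ n = …`).

## References
* [KellerYin2024] T. Keller, M. Yin, arXiv:2402.12781v2: Thm. 3.0.8 (IMC2), Rem. 3.0.9, §0.1, §1.4
  (eq. `char to f`, L1077–L1086), Prop. 1.3.1, Thm. 1.5.1, Thms. 2.2.1–2.2.3, §4.2 proof of Thm. 4.2.1.
* [CastellaGrossiLeeSkinner2022] Invent. Math. 227 (2022): Thm. 5.1.3 with §5.1.2; Thm. 4.2.2;
  Thm. 4.1.1, Rem. 4.1.2, Thm. 3.2.1, Prop. 4.2.1; proof of Thm. 5.3.1 (5.4).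
* [BertoliniDarmonPrasanna2013] Duke Math. J. 162: Thm. 5.13 (source of Thm. 5.1.3).
* HOME/bsd-eis-ky-MEMO-1.md §2–§3, §8; HOME/REF-VERDICT-ky-MEMO-1.md; HOME/TARGET.md §1.1 ROUTING
  v1.2–v1.4.
-/

set_option autoImplicit false

noncomputable section

open scoped Classical

open WeierstrassCurve NumberField IsDedekindDomain Field Literature.NumberTheory.EllipticCurves
  Literature.NumberTheory.EllipticCurves.ModularForms Literature.NumberTheory.QuadraticFields
  Literature.NumberTheory.EllipticCurves.Rank1Residual
  Literature.NumberTheory.EllipticCurves.Castella2018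

namespace Literature.NumberTheory.EllipticCurves.KellerYin2024

/-- **OPEN HYPOTHESIS — UNREFEREED PREPRINT (Keller–Yin, arXiv:2402.12781v2, 2024), Theorem 3.0.8
(label `IMC`, statement (IMC2)) for an elliptic curve over `ℚ` at a GOOD ANOMALOUS Eisenstein prime,
read at the trivial character and combined with the published Bertolini–Darmon–Prasanna formula
([CGLS] Thm. 5.1.3) as [CGLS] combine (5.4) with Thm. 5.1.3.** KY Thm. 3.0.8 (verbatim): "Assume `f`
has weight `2r` where `r` is odd. Assume that `p = v v̄` splits in `K` and `H⁰(K, ρ̄_f) = 0`. Then …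
(IMC2) Both `H¹_{𝓕_nr}(K,𝐓)` and `𝔛_f = H¹_{𝓕_nr}(K,M_f)^∨` are `Λ`-torsion, and the equality
`Char_Λ(𝔛_f)Λ^nr = (𝓛_f)` holds in `Λ^nr`" (standing: `K` a Heegner field for `N`, `D_K` odd
`≠ −3`; `p > 2` good; the lattice `T_f` normalised as in §1.4: "`ρ̄_f|_{G_K}` non-split … with
`φ̃|_{G_{K_v}} = ω`"). [CGLS] Thm. 5.1.3 (verbatim): "let `p > 2` be a prime of good reduction for `E`
such that `p = v v̄` splits in `K`. Then `𝓛_E(0) = c_E⁻² · (1 − a_p p⁻¹ + p⁻¹)² · log_{ω_E}(P_K)²`."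
COMBINED at `𝟙` (as in [CGLS] (5.4)): `𝔛_E` is `Λ`-torsion and a generator `𝓕_E` of `char_Λ(𝔛_E)`
has `𝓕_E(0) = u · c_E⁻² (1 − a_p p⁻¹ + p⁻¹)² log_{ω_E}(P_K)²` with `u ∈ ℤ_p^×`. TRANSCRIBED with the
dictionary of the sibling PUBLISHED fact `CastellaGrossiLeeSkinner2022.display54_thm513_generator_constantCoeff`
VERBATIM — `W` globally minimal, `2 < p`, `Good W p`, `Red W p`; `K` imaginary quadratic with (Heeg)
for `N_E`, (spl), `D_K` odd `≠ −3`, (Sel) `corank Sel_{p^∞}(E/K) = 1`; `(ι, v, vbar, κ, γ)`,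
`𝔛_E = AcSelmer.XAc (W.baseChange K) p κ vbar ∅ γ` (Greenberg condition: strict at `v̄`, relaxed at
`v`; same characteristic ideal as KY's `𝓕_nr`, KY L1633); `(Dt, H, ιC, P)`, `Dt.c = c_E`,
`ιC(P) = P_K`; `log_{ω_E}(P_K) = log_W(z(m₀ • P_ι))/m₀` — EXCEPT: `Anom W p` (KY's new case,
"one of `φ|_{G_p}, ψ|_{G_p}` is trivial") replaces `¬ Anom W p`; and TWO binders are added, KY's
lattice normalisation "no rational `p`-line of `E` is unramified at `p`"
(`∀ Φ, IsRationalLine W p Φ → ¬ LineUnramifiedAt W p Φ`: the good lattice, module docstring) and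
KY's hypothesis `H⁰(K, ρ̄_f) = 0` (`∀ Q : E(K), p • Q = 0 → Q = 0`). NEVER cite this `Prop` as a
theorem; take it as an explicit hypothesis. Verification status: the cell's line-by-line check of
this statement (memo `bsd-eis-ky-MEMO-1.md` §2 L5–L9/L11 + §3, with (I2) closed in MEMO-2 §11) was
scored PASS by the cell's referee (`REF-VERDICT-ky-MEMO-1.md`); the label is the planner's to move.
Role: input L7–L9/L11 of the cell's THEOREM A (row A1: type A, `r_an = 1` ⟹ `BSD(E,p)`), the ONE
preprint input of that theorem.
[claim: KellerYin2024, status: under-review]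
[cite: KellerYin2024, Thm. 3.0.8 (IMC2) (arXiv:2402.12781v2 TeX L1618–L1640) with §0.1 (L233–L235) and §1.4 (L1077–L1086)]
[cite: CastellaGrossiLeeSkinner2022, Thm. 5.1.3 (TeX `thmpadicGZ`, L2463–L2471) with §5.1.2, and proof of Thm. 5.3.1 display (5.4) (L2616–L2634)]
[cite: BertoliniDarmonPrasanna2013, Thm. 5.13 (the source of [CGLS] Thm. 5.1.3)] -/
def thm308_imc2_bdpValue_goodLattice_OPEN : Prop :=
  ∀ (W : WeierstrassCurve ℚ) [W.IsElliptic] [W.IsGloballyMinimal] (p : ℕ) [Fact p.Prime],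
    2 < p → Good W p → Red W p → Anom W p →
    (∀ Φ : AddSubgroup (geomTorsion W (p : ℤ)), IsRationalLine W p Φ → ¬ LineUnramifiedAt W p Φ) →
    ∀ (K : Type) [Field K] [NumberField K], IsImaginaryQuadratic K →
      SatisfiesHeegnerHypothesis (W.conductorNorm ℤ) K → SatisfiesHeegnerHypothesis p K →
      Odd (NumberField.discr K) → NumberField.discr K ≠ -3 →
      (∀ Q : (W.baseChange K).toAffine.Point, p • Q = 0 → Q = 0) →
      (W.baseChange K).selmerCorank p = 1 →
    ∀ (ι : K →+* ℚ_[p]) (v vbar : HeightOneSpectrum (𝓞 K)),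
      (∀ x : 𝓞 K, x ∈ v.asIdeal ↔ ‖ι (x : K)‖ < 1) →
      ((p : ℕ) : 𝓞 K) ∈ vbar.asIdeal → vbar ≠ v →
    ∀ (κ : ZpExtension K p), κ.IsAnticyclotomic →
    ∀ (γ : absoluteGaloisGroup K) [Fact (κ.IsTopGenerator γ)],
    ∀ (N : ℕ) [NeZero N] (Dt : ModularParametrizationData W N)
      (H : HeegnerDatum N (NumberField.discr K)) (ιC : K →+* ℂ) (P : (W.baseChange K).toAffine.Point),
      WeierstrassCurve.Affine.Point.map ιC.toRatAlgHom P = heegnerPointComplex Dt H →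
      Module.IsTorsion (IwasawaAlgebra p) (AcSelmer.XAc (W.baseChange K) p κ vbar ∅ γ) ∧
      ∃ F : IwasawaAlgebra p,
        AcSelmer.XAc.charIdeal (W.baseChange K) p κ vbar ∅ γ = Ideal.span {F} ∧
        ∃ u : ℤ_[p]ˣ,
          ((PowerSeries.constantCoeff F : ℤ_[p]) : ℚ_[p]) =
            ((u : ℤ_[p]) : ℚ_[p]) * ((Dt.c : ℚ_[p])⁻¹) ^ 2 *
              (1 - (W.frobeniusTrace p : ℚ_[p]) * (p : ℚ_[p])⁻¹ + (p : ℚ_[p])⁻¹) ^ 2 *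
              ((W.baseChange ℚ_[p]).padicLogPoint (formalIndex W p • padicPointOf W p ι P) /
                (formalIndex W p : ℚ_[p])) ^ 2

/-! ### A `p`-adic valuation computation (standard API; no mathematical content of its own) -/

section Valuation

variable {p : ℕ} [hp : Fact p.Prime]

/-- `ord_p` of the right-hand side of (5.4) ∘ Thm. 5.1.3: for a unit `u ∈ ℤ_p^×`, integers `c, a`,
`L ∈ ℚ_p` and `m ∈ ℕ`, if `u · c⁻² · (1 − a p⁻¹ + p⁻¹)² · (L/m)² ≠ 0` then its valuation is
`2·(ord_p(1 − a + p) − 1 + (ord_p L − ord_p m)) − 2·ord_p c` (each factor is non-zero, `ord_p` is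
additive, `1 − a p⁻¹ + p⁻¹ = (1 − a + p)/p`). Private helper, verbatim the sibling's
(`BDPValueAtTrivialCharacter.lean`, where it is private too). [folklore] -/
private theorem valuation_unit_mul_bdpShape (u : ℤ_[p]ˣ) (c a : ℤ) (L : ℚ_[p]) (m : ℕ)
    (h : ((u : ℤ_[p]) : ℚ_[p]) * ((c : ℚ_[p])⁻¹) ^ 2 *
        (1 - (a : ℚ_[p]) * (p : ℚ_[p])⁻¹ + (p : ℚ_[p])⁻¹) ^ 2 * (L / (m : ℚ_[p])) ^ 2 ≠ 0) :
    (((u : ℤ_[p]) : ℚ_[p]) * ((c : ℚ_[p])⁻¹) ^ 2 *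
        (1 - (a : ℚ_[p]) * (p : ℚ_[p])⁻¹ + (p : ℚ_[p])⁻¹) ^ 2 * (L / (m : ℚ_[p])) ^ 2).valuation =
      2 * ((padicValInt p (1 - a + p) : ℤ) - 1 + (L.valuation - (padicValNat p m : ℤ))) -
        2 * (padicValInt p c : ℤ) := by
  have hp0 : (p : ℚ_[p]) ≠ 0 := by exact_mod_cast hp.out.ne_zero
  have hu0 : ((u : ℤ_[p]) : ℚ_[p]) ≠ 0 := PadicInt.coe_ne_zero.2 u.ne_zero
  have hc0 : ((c : ℚ_[p])⁻¹) ≠ 0 := by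
    intro h0; apply h; rw [h0]; ring
  have hA0 : (1 - (a : ℚ_[p]) * (p : ℚ_[p])⁻¹ + (p : ℚ_[p])⁻¹) ≠ 0 := by
    intro h0; apply h; rw [h0]; ring
  have hLm0 : L / (m : ℚ_[p]) ≠ 0 := by
    intro h0; apply h; rw [h0]; ring
  have hL0 : L ≠ 0 := by
    intro h0; apply hLm0; rw [h0, zero_div]
  have hm0 : (m : ℚ_[p]) ≠ 0 := by
    intro h0; apply hLm0; rw [h0, div_zero]
  -- `1 − a p⁻¹ + p⁻¹ = (1 − a + p)/p`
  have hAeq : (1 - (a : ℚ_[p]) * (p : ℚ_[p])⁻¹ + (p : ℚ_[p])⁻¹) =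
      ((1 - a + p : ℤ) : ℚ_[p]) * (p : ℚ_[p])⁻¹ := by
    push_cast
    field_simp
    ring
  have hA1 : ((1 - a + p : ℤ) : ℚ_[p]) ≠ 0 := by
    intro h0; apply hA0; rw [hAeq, h0, zero_mul]
  -- valuations of the four factors
  have hvu : ((u : ℤ_[p]) : ℚ_[p]).valuation = 0 := by
    simp only [PadicInt.valuation_coe, padicInt_valuation_eq_zero_of_isUnit u.isUnit, Nat.cast_zero]
  have hvc : ((c : ℚ_[p])⁻¹).valuation = -(padicValInt p c : ℤ) := by
    rw [Padic.valuation_inv, Padic.valuation_intCast]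
  have hvA : (1 - (a : ℚ_[p]) * (p : ℚ_[p])⁻¹ + (p : ℚ_[p])⁻¹).valuation =
      (padicValInt p (1 - a + p) : ℤ) - 1 := by
    rw [hAeq, Padic.valuation_mul hA1 (inv_ne_zero hp0), Padic.valuation_intCast,
      Padic.valuation_inv, Padic.valuation_p]
    ring
  have hvL : (L / (m : ℚ_[p])).valuation = L.valuation - (padicValNat p m : ℤ) := by
    rw [div_eq_mul_inv, Padic.valuation_mul hL0 (inv_ne_zero hm0), Padic.valuation_inv,
      Padic.valuation_natCast]
    ring
  rw [Padic.valuation_mul (mul_ne_zero (mul_ne_zero hu0 (pow_ne_zero 2 hc0)) (pow_ne_zero 2 hA0))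
      (pow_ne_zero 2 hLm0),
    Padic.valuation_mul (mul_ne_zero hu0 (pow_ne_zero 2 hc0)) (pow_ne_zero 2 hA0),
    Padic.valuation_mul hu0 (pow_ne_zero 2 hc0), Padic.valuation_pow, Padic.valuation_pow,
    Padic.valuation_pow, hvu, hvc, hvA, hvL]
  ring

end Valuation

variable {W : WeierstrassCurve ℚ} [W.IsElliptic] [W.IsGloballyMinimal] {p : ℕ} [Fact p.Prime]

/-! ### Bookkeeping consumers (verbatim the sibling's, for the OPEN fact) -/

/-- **Every generator satisfies the identity (with its own unit)**, granted the OPEN fact: if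
`char_Λ(𝔛_E) = (𝓖)` for ANY `𝓖 ∈ Λ`, then `𝓖(0) = u' · c_E⁻² (1 − a_p p⁻¹ + p⁻¹)² log_{ω_E}(P_K)²` for
some `u' ∈ ℤ_p^×` (two generators of a principal ideal of the domain `Λ = ℤ_p⟦T⟧` differ by a unit of
`Λ`, whose constant term is a unit of `ℤ_p`). [claim: KellerYin2024, status: under-review]
[cite: KellerYin2024, Thm. 3.0.8 (IMC2)] [cite: CastellaGrossiLeeSkinner2022, Thm. 5.1.3, (5.4)] -/
theorem generator_constantCoeff_eq_of_thm308 (h : thm308_imc2_bdpValue_goodLattice_OPEN)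
    (hp : 2 < p) (hgood : Good W p) (hred : Red W p) (han : Anom W p)
    (hGL : ∀ Φ : AddSubgroup (geomTorsion W (p : ℤ)), IsRationalLine W p Φ → ¬ LineUnramifiedAt W p Φ)
    (K : Type) [Field K] [NumberField K] (hK : IsImaginaryQuadratic K)
    (hHN : SatisfiesHeegnerHypothesis (W.conductorNorm ℤ) K) (hHp : SatisfiesHeegnerHypothesis p K)
    (hodd : Odd (NumberField.discr K)) (h3 : NumberField.discr K ≠ -3)
    (hEK : ∀ Q : (W.baseChange K).toAffine.Point, p • Q = 0 → Q = 0)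
    (hSel : (W.baseChange K).selmerCorank p = 1)
    (ι : K →+* ℚ_[p]) (v vbar : HeightOneSpectrum (𝓞 K))
    (hv : ∀ x : 𝓞 K, x ∈ v.asIdeal ↔ ‖ι (x : K)‖ < 1)
    (hvbar : ((p : ℕ) : 𝓞 K) ∈ vbar.asIdeal) (hne : vbar ≠ v)
    (κ : ZpExtension K p) (hκ : κ.IsAnticyclotomic)
    (γ : absoluteGaloisGroup K) [Fact (κ.IsTopGenerator γ)]
    {N : ℕ} [NeZero N] (Dt : ModularParametrizationData W N)
    (H : HeegnerDatum N (NumberField.discr K)) (ιC : K →+* ℂ) (P : (W.baseChange K).toAffine.Point)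
    (hP : WeierstrassCurve.Affine.Point.map ιC.toRatAlgHom P = heegnerPointComplex Dt H)
    (G : IwasawaAlgebra p) (hG : AcSelmer.XAc.charIdeal (W.baseChange K) p κ vbar ∅ γ = Ideal.span {G}) :
    ∃ u' : ℤ_[p]ˣ,
      ((PowerSeries.constantCoeff G : ℤ_[p]) : ℚ_[p]) =
        ((u' : ℤ_[p]) : ℚ_[p]) * ((Dt.c : ℚ_[p])⁻¹) ^ 2 *
          (1 - (W.frobeniusTrace p : ℚ_[p]) * (p : ℚ_[p])⁻¹ + (p : ℚ_[p])⁻¹) ^ 2 *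
          ((W.baseChange ℚ_[p]).padicLogPoint (formalIndex W p • padicPointOf W p ι P) /
            (formalIndex W p : ℚ_[p])) ^ 2 := by
  obtain ⟨-, F, hF, u, hu⟩ := h W p hp hgood hred han hGL K hK hHN hHp hodd h3 hEK hSel ι v vbar hv
    hvbar hne κ hκ γ N Dt H ιC P hP
  -- `G = F · w` for a unit `w` of `Λ`; `w(0)` is a unit of `ℤ_p`
  obtain ⟨w, rfl⟩ := Ideal.span_singleton_eq_span_singleton.mp (hF.symm.trans hG)
  have hw : IsUnit (PowerSeries.constantCoeff (w : IwasawaAlgebra p)) :=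
    PowerSeries.isUnit_constantCoeff _ w.isUnit
  refine ⟨u * hw.unit, ?_⟩
  rw [map_mul, PadicInt.coe_mul, hu, Units.val_mul, PadicInt.coe_mul, IsUnit.unit_spec]
  ring

/-- **The identity in valuations**, granted the OPEN fact — the currency of the control theorem
(`thm511_anticyclotomicControl_of_torsionFree`) and of `AcSelmer.XAc.HasCharValuationAt`: for EVERY
generator `𝓖` of `char_Λ(𝔛_E)` with `𝓖(0) ≠ 0`, `ord_p 𝓖(0) = 2·(ord_p(1 − a_p + p) − 1 +
ord_p log_{ω_E} P_K) − 2·ord_p c_E` (`ord_p log_{ω_E} P_K = padicLogOrd W p ι P`). At an anomalous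
prime `ord_p(1 − a_p + p) ≥ 1`, so the anomaly factor `(1 − a_p p⁻¹ + p⁻¹)` is a `p`-adic INTEGER of
valuation `ord_p(1 − a_p + p) − 1 ≥ 0` here (it is a unit in the sibling's non-anomalous case).
[claim: KellerYin2024, status: under-review] [cite: KellerYin2024, Thm. 3.0.8 (IMC2)]
[cite: CastellaGrossiLeeSkinner2022, Thm. 5.1.3, (5.4)] -/
theorem valuation_generator_constantCoeff_of_thm308 (h : thm308_imc2_bdpValue_goodLattice_OPEN)
    (hp : 2 < p) (hgood : Good W p) (hred : Red W p) (han : Anom W p)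
    (hGL : ∀ Φ : AddSubgroup (geomTorsion W (p : ℤ)), IsRationalLine W p Φ → ¬ LineUnramifiedAt W p Φ)
    (K : Type) [Field K] [NumberField K] (hK : IsImaginaryQuadratic K)
    (hHN : SatisfiesHeegnerHypothesis (W.conductorNorm ℤ) K) (hHp : SatisfiesHeegnerHypothesis p K)
    (hodd : Odd (NumberField.discr K)) (h3 : NumberField.discr K ≠ -3)
    (hEK : ∀ Q : (W.baseChange K).toAffine.Point, p • Q = 0 → Q = 0)
    (hSel : (W.baseChange K).selmerCorank p = 1)
    (ι : K →+* ℚ_[p]) (v vbar : HeightOneSpectrum (𝓞 K))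
    (hv : ∀ x : 𝓞 K, x ∈ v.asIdeal ↔ ‖ι (x : K)‖ < 1)
    (hvbar : ((p : ℕ) : 𝓞 K) ∈ vbar.asIdeal) (hne : vbar ≠ v)
    (κ : ZpExtension K p) (hκ : κ.IsAnticyclotomic)
    (γ : absoluteGaloisGroup K) [Fact (κ.IsTopGenerator γ)]
    {N : ℕ} [NeZero N] (Dt : ModularParametrizationData W N)
    (H : HeegnerDatum N (NumberField.discr K)) (ιC : K →+* ℂ) (P : (W.baseChange K).toAffine.Point)
    (hP : WeierstrassCurve.Affine.Point.map ιC.toRatAlgHom P = heegnerPointComplex Dt H)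
    (G : IwasawaAlgebra p) (hG : AcSelmer.XAc.charIdeal (W.baseChange K) p κ vbar ∅ γ = Ideal.span {G})
    (hG0 : PowerSeries.constantCoeff G ≠ 0) :
    ((PowerSeries.constantCoeff G).valuation : ℤ) =
      2 * ((padicValInt p (1 - W.frobeniusTrace p + p) : ℤ) - 1 + padicLogOrd W p ι P) -
        2 * (padicValInt p Dt.c : ℤ) := by
  obtain ⟨u', hu'⟩ := generator_constantCoeff_eq_of_thm308 h hp hgood hred han hGL K hK hHN hHp hodd
    h3 hEK hSel ι v vbar hv hvbar hne κ hκ γ Dt H ιC P hP G hG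
  -- the left-hand side is non-zero, hence so is the right-hand side
  have hrhs : ((u' : ℤ_[p]) : ℚ_[p]) * ((Dt.c : ℚ_[p])⁻¹) ^ 2 *
      (1 - (W.frobeniusTrace p : ℚ_[p]) * (p : ℚ_[p])⁻¹ + (p : ℚ_[p])⁻¹) ^ 2 *
      ((W.baseChange ℚ_[p]).padicLogPoint (formalIndex W p • padicPointOf W p ι P) /
        (formalIndex W p : ℚ_[p])) ^ 2 ≠ 0 := by
    rw [← hu']
    exact PadicInt.coe_ne_zero.2 hG0
  have hval := congrArg Padic.valuation hu'
  rw [PadicInt.valuation_coe, valuation_unit_mul_bdpShape u' Dt.c (W.frobeniusTrace p) _ _ hrhs] at hval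
  rw [hval, padicLogOrd]

/-- **KY Thm. 3.0.8 (IMC2) ∘ [CGLS] Thm. 5.1.3 at the trivial character in the packaged currency**
`AcSelmer.XAc.HasCharValuationAt … n` ("`𝔛_E` is `Λ`-torsion with a generator `𝓕`, `𝓕(0) ≠ 0`,
`ord_p 𝓕(0) = n`") `∧ n = 2·(ord_p(1 − a_p + p) − 1 + ord_p log_{ω_E} P_K) − 2·ord_p c_E`, granted the
OPEN fact and ONE generator with non-zero constant term (at the cell's data this comes from the
control theorem `thm511_anticyclotomicControl_of_torsionFree`, or from `P_K` non-torsion).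
[claim: KellerYin2024, status: under-review] [cite: KellerYin2024, Thm. 3.0.8 (IMC2)]
[cite: CastellaGrossiLeeSkinner2022, Thm. 5.1.3, proof of Thm. 5.3.1 (5.4)] -/
theorem hasCharValuationAt_of_thm308 (h : thm308_imc2_bdpValue_goodLattice_OPEN)
    (hp : 2 < p) (hgood : Good W p) (hred : Red W p) (han : Anom W p)
    (hGL : ∀ Φ : AddSubgroup (geomTorsion W (p : ℤ)), IsRationalLine W p Φ → ¬ LineUnramifiedAt W p Φ)
    (K : Type) [Field K] [NumberField K] (hK : IsImaginaryQuadratic K)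
    (hHN : SatisfiesHeegnerHypothesis (W.conductorNorm ℤ) K) (hHp : SatisfiesHeegnerHypothesis p K)
    (hodd : Odd (NumberField.discr K)) (h3 : NumberField.discr K ≠ -3)
    (hEK : ∀ Q : (W.baseChange K).toAffine.Point, p • Q = 0 → Q = 0)
    (hSel : (W.baseChange K).selmerCorank p = 1)
    (ι : K →+* ℚ_[p]) (v vbar : HeightOneSpectrum (𝓞 K))
    (hv : ∀ x : 𝓞 K, x ∈ v.asIdeal ↔ ‖ι (x : K)‖ < 1)
    (hvbar : ((p : ℕ) : 𝓞 K) ∈ vbar.asIdeal) (hne : vbar ≠ v)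
    (κ : ZpExtension K p) (hκ : κ.IsAnticyclotomic)
    (γ : absoluteGaloisGroup K) [Fact (κ.IsTopGenerator γ)]
    {N : ℕ} [NeZero N] (Dt : ModularParametrizationData W N)
    (H : HeegnerDatum N (NumberField.discr K)) (ιC : K →+* ℂ) (P : (W.baseChange K).toAffine.Point)
    (hP : WeierstrassCurve.Affine.Point.map ιC.toRatAlgHom P = heegnerPointComplex Dt H)
    (G : IwasawaAlgebra p) (hG : AcSelmer.XAc.charIdeal (W.baseChange K) p κ vbar ∅ γ = Ideal.span {G})
    (hG0 : PowerSeries.constantCoeff G ≠ 0) :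
    ∃ n : ℕ, AcSelmer.XAc.HasCharValuationAt (W.baseChange K) p κ vbar ∅ γ n ∧
      (n : ℤ) = 2 * ((padicValInt p (1 - W.frobeniusTrace p + p) : ℤ) - 1 + padicLogOrd W p ι P) -
        2 * (padicValInt p Dt.c : ℤ) := by
  obtain ⟨htors, -⟩ := h W p hp hgood hred han hGL K hK hHN hHp hodd h3 hEK hSel ι v vbar hv hvbar hne
    κ hκ γ N Dt H ιC P hP
  exact ⟨(PowerSeries.constantCoeff G).valuation,
    AcSelmer.XAc.hasCharValuationAt_of_eq htors hG hG0 rfl,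
    valuation_generator_constantCoeff_of_thm308 h hp hgood hred han hGL K hK hHN hHp hodd h3 hEK hSel ι v
      vbar hv hvbar hne κ hκ γ Dt H ιC P hP G hG hG0⟩

end Literature.NumberTheory.EllipticCurves.KellerYin2024

end
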